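import Mathlib
import HarnessLib
import Summits.NavierStokesRegularity.NavierStokesRegularity.Theorems.TaylorModelRungThreeCertificateBoxFieldDSparse
import Summits.NavierStokesRegularity.NavierStokesRegularity.Theorems.TaylorModelRungThreeCertificateIntervalDJetsSym

/-!
# Crux K1b-DR (stmt-NavierStokesRegularity-23954), line `taylor-model` — the LINEARISED sparse twin `linSym` of the symmetrised cascade
# field at a state box, and the columns of the one-step variational matrix `W_k(H²)` (PROPAGATE-V-SPEC-cert1 §2 C) through it

For a fixed state box-vector `A` the symmetrised bilinear map `w ↦ qB d u w + qB d w u` (`u ∈ A`) is enclosed by ONE sparse operator table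
`linSym T coefB prec mt A` (per target coordinate: for every active monomial `(a, b, μ)` the two entries
`(idx b k₂, coefBox · A[idx a k₁])` and `(idx a k₁, coefBox · A[idx b k₂])`), applied to any direction column by `IntervalD.applyLinA`.
Building the tables of the state levels ONCE (`IntervalD.opsOf`) and running all `n` basis columns against them (`IntervalD.wColLevelsA` /
`wMatLevelsA`) halves the monomial products of the dominant §2 C cost and removes the per-column re-linearisation. Soundness:
`isLinSymEnclosureA_linSym : IsLinSymEnclosureA T.wv (qBf d) T.n prec (T.linSym coefB prec (T.monosTable coefB))`, whence
**`mem_varJet_of_wColLevelsA_lin`**: for `y` with window coordinates in `Y` and a direction `v` with window coordinates in `D`, every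
`varJet d.Qb y v k` (`k ≤ K`) has its window coordinates in
`wColLevelsA T.n prec (opsOf (T.linSym coefB prec mt) (jetLevelsA T.n (T.qBboxMA coefB prec mt) prec Y K) K) D K`, `mt := T.monosTable coefB`.

MODEL-lattice bookkeeping only (rung TL-M3); nothing here concerns the Navier–Stokes equations.
-/

-- the sub-problem namespace repeats the summit name by design (D-0017)
set_option linter.dupNamespace false

namespace Summit.NavierStokesRegularity.NavierStokesRegularity.Theorems.TaylorModelCert

open scoped BigOperators
open Literature.Analysis.FluidPDE.TaoCascade Literature.Analysis.FluidPDE.TaoCascade.TaylorChain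
open Summit.NavierStokesRegularity.NavierStokesRegularity.Theorems.TaylorModelReadout (trunc trunc_apply qB varJet)

namespace CertTables

section Defs

variable {K : Type} [Field K] [LinearOrder K]

/-- Entry of the LEFT linearisation (state in slot 1): `(idx b k₂, coefBox · A[idx a k₁])`. [folklore] -/
def entryL (T : CertTables K) (coefB : Fin 4 → Fin 4 → Fin 4 → ℕ → ℤ → IntervalD) (prec : ℕ) (A : Array IntervalD) (i : Fin 4) (k : ℤ)
    (t : ℕ × ℕ × ℕ) : ℕ × IntervalD :=
  (T.idx ⟨t.2.1 % 4, Nat.mod_lt _ (by omega)⟩ (fShell₂ t.2.2 k),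
    IntervalD.mulR prec (coefB ⟨t.1 % 4, Nat.mod_lt _ (by omega)⟩ ⟨t.2.1 % 4, Nat.mod_lt _ (by omega)⟩ i t.2.2 k)
      (IntervalD.aget A (T.idx ⟨t.1 % 4, Nat.mod_lt _ (by omega)⟩ (fShell₁ t.2.2 k))))

/-- Entry of the RIGHT linearisation (state in slot 2): `(idx a k₁, coefBox · A[idx b k₂])`. [folklore] -/
def entryR (T : CertTables K) (coefB : Fin 4 → Fin 4 → Fin 4 → ℕ → ℤ → IntervalD) (prec : ℕ) (A : Array IntervalD) (i : Fin 4) (k : ℤ)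
    (t : ℕ × ℕ × ℕ) : ℕ × IntervalD :=
  (T.idx ⟨t.1 % 4, Nat.mod_lt _ (by omega)⟩ (fShell₁ t.2.2 k),
    IntervalD.mulR prec (coefB ⟨t.1 % 4, Nat.mod_lt _ (by omega)⟩ ⟨t.2.1 % 4, Nat.mod_lt _ (by omega)⟩ i t.2.2 k)
      (IntervalD.aget A (T.idx ⟨t.2.1 % 4, Nat.mod_lt _ (by omega)⟩ (fShell₂ t.2.2 k))))

/-- **The linearised symmetric twin at the state box `A`**: per window coordinate `c < n`, the left entries followed by the right entries of
the active monomials `mt[c]` (call with `mt := T.monosTable coefB`). [folklore] -/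
def linSym (T : CertTables K) (coefB : Fin 4 → Fin 4 → Fin 4 → ℕ → ℤ → IntervalD) (prec : ℕ) (mt : Array (List (ℕ × ℕ × ℕ)))
    (A : Array IntervalD) : Array (List (ℕ × IntervalD)) :=
  Array.ofFn fun c : Fin T.n =>
    (tget mt c).map (T.entryL coefB prec A (T.wi c) (T.wk c)) ++ (tget mt c).map (T.entryR coefB prec A (T.wi c) (T.wk c))

end Defs

section Sound

variable {K : Type} [Field K] {φ : K →+* ℝ} (T : CertTables K) {coefB : Fin 4 → Fin 4 → Fin 4 → ℕ → ℤ → IntervalD}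

omit [Field K] in
/-- `oget` of `linSym` below `n`. [folklore] -/
theorem oget_linSym (prec : ℕ) (mt : Array (List (ℕ × ℕ × ℕ))) (A : Array IntervalD) {c : ℕ} (hc : c < T.n) :
    IntervalD.oget (T.linSym coefB prec mt A) c =
      (tget mt c).map (T.entryL coefB prec A (T.wi c) (T.wk c)) ++ (tget mt c).map (T.entryR coefB prec A (T.wi c) (T.wk c)) := by
  unfold IntervalD.oget linSym
  rw [dif_pos (by rw [Array.size_ofFn]; exact hc), Array.getElem_ofFn]

/-- **The linearised symmetric twin encloses `qB d u w + qB d w u`** for `u` in the state box and `w` in the direction box. [folklore] -/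
theorem isLinSymEnclosureA_linSym (hco : T.CoefOK φ) (hcB : CoefBoxOK φ T coefB) (prec : ℕ) :
    IntervalD.IsLinSymEnclosureA T.wv (qBf (T.toCertData φ)) T.n prec (T.linSym coefB prec (T.monosTable coefB)) := by
  intro A W u w _ _ hu hw c hc
  set d := T.toCertData φ with hd
  set i := T.wi c
  set k := T.wk c
  have hk : -T.Kb ≤ k ∧ k ≤ T.Ka := T.InW_wk hc
  have hKb : d.Kb = T.Kb := rfl
  have hKa : d.Ka = T.Ka := rfl
  have hu' : ∀ (a' : Fin 4) {k' : ℤ}, (-T.Kb ≤ k' ∧ k' ≤ T.Ka) → IntervalD.mem (u a' k') (IntervalD.aget A (T.idx a' k')) := by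
    intro a' k' hk'
    have h := hu (T.idx a' k') (T.idx_lt_n a' hk')
    rwa [T.wv_idx u a' hk'] at h
  have hw' : ∀ (a' : Fin 4) {k' : ℤ}, (-T.Kb ≤ k' ∧ k' ≤ T.Ka) → IntervalD.mem (w a' k') (IntervalD.aget W (T.idx a' k')) := by
    intro a' k' hk'
    have h := hw (T.idx a' k') (T.idx_lt_n a' hk')
    rwa [T.wv_idx w a' hk'] at h
  -- the computed side: two folds over the active monomials
  unfold IntervalD.applyLinA
  rw [IntervalD.aget_ofFn _ hc, T.oget_linSym prec _ A hc, T.tget_monosTable hc, List.foldl_append, List.foldl_map, List.foldl_map]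
  unfold activeMonos
  -- the real side: two 64-term sums
  show IntervalD.mem (qB d u w i k + qB d w u i k) _
  unfold qB
  rw [hKb, hKa, if_pos hk, if_pos hk]
  simp only [sum_fin4_eq, sum_shiftSet_eq]
  rw [sum3_eq_tripleList, sum3_eq_tripleList]
  -- shared per-monomial facts
  have key : ∀ t ∈ tripleList, ∀ (y z : Fin 4 → ℤ → ℝ),
      let a' : Fin 4 := ⟨t.1 % 4, Nat.mod_lt _ (by omega)⟩
      let b' : Fin 4 := ⟨t.2.1 % 4, Nat.mod_lt _ (by omega)⟩
      d.α a' b' i (shifts.getD t.2.2 (0, 0, 0)) * (1 + 1 : ℝ) ^ ((5 : ℝ) * (k - (shifts.getD t.2.2 (0, 0, 0)).2.2) / 2) *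
          (trunc d y a' (k - (shifts.getD t.2.2 (0, 0, 0)).2.2 + (shifts.getD t.2.2 (0, 0, 0)).1) *
            trunc d z b' (k - (shifts.getD t.2.2 (0, 0, 0)).2.2 + (shifts.getD t.2.2 (0, 0, 0)).2.1)) =
        φ (T.coefAt a' b' i t.2.2 k) *
          ((if -T.Kb ≤ fShell₁ t.2.2 k ∧ fShell₁ t.2.2 k ≤ T.Ka then y a' (fShell₁ t.2.2 k) else 0) *
            (if -T.Kb ≤ fShell₂ t.2.2 k ∧ fShell₂ t.2.2 k ≤ T.Ka then z b' (fShell₂ t.2.2 k) else 0)) := by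
    intro t ht y z
    obtain ⟨-, -, hμ⟩ := tripleList_lt _ ht
    dsimp only
    rw [hco _ _ i t.2.2 k hμ hk.1 hk.2, hd, toCertData_α, shifts_getD t.2.2 hμ, if_pos hμ, one_add_one_eq_two]
    rfl
  have hzero : ∀ t ∈ tripleList, T.isActive coefB i k t = false → ∀ (y z : Fin 4 → ℤ → ℝ),
      φ (T.coefAt ⟨t.1 % 4, Nat.mod_lt _ (by omega)⟩ ⟨t.2.1 % 4, Nat.mod_lt _ (by omega)⟩ i t.2.2 k) *
        ((if -T.Kb ≤ fShell₁ t.2.2 k ∧ fShell₁ t.2.2 k ≤ T.Ka then y ⟨t.1 % 4, Nat.mod_lt _ (by omega)⟩ (fShell₁ t.2.2 k) else 0) *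
          (if -T.Kb ≤ fShell₂ t.2.2 k ∧ fShell₂ t.2.2 k ≤ T.Ka then z ⟨t.2.1 % 4, Nat.mod_lt _ (by omega)⟩ (fShell₂ t.2.2 k) else 0)) = 0 := by
    intro t ht hin y z
    obtain ⟨-, -, hμ⟩ := tripleList_lt _ ht
    simp only [isActive, Bool.and_eq_false_iff, Bool.not_eq_false', decide_eq_false_iff_not, decide_eq_true_eq] at hin
    rcases hin with hwin | hz
    · rcases not_and_or.1 hwin with h1 | h2
      · rw [if_neg h1, zero_mul, mul_zero]
      · rw [if_neg h2, mul_zero, mul_zero]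
    · rw [IntervalD.eq_zero_of_mem_pointZero hz (hcB _ _ i t.2.2 k hμ hk.1 hk.2), zero_mul]
  -- left terms `qB d u w`, then right terms `qB d w u`
  have h1 := IntervalD.mem_sum_filter_foldl prec
    (fun t : ℕ × ℕ × ℕ => φ (T.coefAt ⟨t.1 % 4, Nat.mod_lt _ (by omega)⟩ ⟨t.2.1 % 4, Nat.mod_lt _ (by omega)⟩ i t.2.2 k) *
      ((if -T.Kb ≤ fShell₁ t.2.2 k ∧ fShell₁ t.2.2 k ≤ T.Ka then u ⟨t.1 % 4, Nat.mod_lt _ (by omega)⟩ (fShell₁ t.2.2 k) else 0) *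
        (if -T.Kb ≤ fShell₂ t.2.2 k ∧ fShell₂ t.2.2 k ≤ T.Ka then w ⟨t.2.1 % 4, Nat.mod_lt _ (by omega)⟩ (fShell₂ t.2.2 k) else 0)))
    (fun t => IntervalD.mulR prec (T.entryL coefB prec A i k t).2 (IntervalD.aget W (T.entryL coefB prec A i k t).1))
    (T.isActive coefB i k) tripleList (fun t ht hin => hzero t ht hin u w) (fun t ht hact => by
      obtain ⟨-, -, hμ⟩ := tripleList_lt _ ht
      simp only [isActive, Bool.and_eq_true, decide_eq_true_eq] at hact
      obtain ⟨⟨hw1, hw2⟩, -⟩ := hact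
      dsimp only [entryL]
      rw [if_pos hw1, if_pos hw2, ← mul_assoc]
      exact IntervalD.mem_mulR prec (IntervalD.mem_mulR prec (hcB _ _ i t.2.2 k hμ hk.1 hk.2) (hu' _ hw1)) (hw' _ hw2))
    0 _ IntervalD.mem_zero
  have h2 := IntervalD.mem_sum_filter_foldl prec
    (fun t : ℕ × ℕ × ℕ => φ (T.coefAt ⟨t.1 % 4, Nat.mod_lt _ (by omega)⟩ ⟨t.2.1 % 4, Nat.mod_lt _ (by omega)⟩ i t.2.2 k) *
      ((if -T.Kb ≤ fShell₁ t.2.2 k ∧ fShell₁ t.2.2 k ≤ T.Ka then w ⟨t.1 % 4, Nat.mod_lt _ (by omega)⟩ (fShell₁ t.2.2 k) else 0) *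
        (if -T.Kb ≤ fShell₂ t.2.2 k ∧ fShell₂ t.2.2 k ≤ T.Ka then u ⟨t.2.1 % 4, Nat.mod_lt _ (by omega)⟩ (fShell₂ t.2.2 k) else 0)))
    (fun t => IntervalD.mulR prec (T.entryR coefB prec A i k t).2 (IntervalD.aget W (T.entryR coefB prec A i k t).1))
    (T.isActive coefB i k) tripleList (fun t ht hin => hzero t ht hin w u) (fun t ht hact => by
      obtain ⟨-, -, hμ⟩ := tripleList_lt _ ht
      simp only [isActive, Bool.and_eq_true, decide_eq_true_eq] at hact
      obtain ⟨⟨hw1, hw2⟩, -⟩ := hact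
      dsimp only [entryR]
      rw [if_pos hw1, if_pos hw2, mul_comm (w _ _), ← mul_assoc]
      exact IntervalD.mem_mulR prec (IntervalD.mem_mulR prec (hcB _ _ i t.2.2 k hμ hk.1 hk.2) (hu' _ hw2)) (hw' _ hw1))
    _ _ h1
  rw [zero_add] at h2
  convert h2 using 2 <;>
    exact congrArg List.sum (List.map_congr_left fun t ht => key t ht _ _)

/-- **Variational jets of the cascade through the shared linearised tables**: window coordinates of `varJet d.Qb y v k` lie in the per-column
levels run against `opsOf (T.linSym coefB prec mt) (jetLevelsA T.n (T.qBboxMA coefB prec mt) prec Y K) K`, `mt := T.monosTable coefB`.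
[folklore] -/
theorem mem_varJet_of_wColLevelsA_lin (hco : T.CoefOK φ) (hcB : CoefBoxOK φ T coefB) (prec K : ℕ) {Y D : Array IntervalD}
    (hY : Y.size = T.n) (hD : D.size = T.n) {y v : Fin 4 → ℤ → ℝ} (hy : ∀ c < T.n, IntervalD.mem (T.wv y c) (IntervalD.aget Y c))
    (hv : ∀ c < T.n, IntervalD.mem (T.wv v c) (IntervalD.aget D c)) :
    ∀ k ≤ K, ∀ c < T.n, IntervalD.mem (T.wv (varJet (T.toCertData φ).Qb y v k) c)
      (IntervalD.aget (IntervalD.lget (IntervalD.wColLevelsA T.n prec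
        (IntervalD.opsOf (T.linSym coefB prec (T.monosTable coefB))
          (IntervalD.jetLevelsA T.n (T.qBboxMA coefB prec (T.monosTable coefB)) prec Y K) K) D K) k) c) := by
  intro k hk c hc
  rw [← varJet_qBf]
  exact IntervalD.mem_varJet_of_wColLevelsA (T := TaylorModelReadout.taylorJet (qBf (T.toCertData φ)))
    (U := varJet (qBf (T.toCertData φ))) (fun x c _ => by rw [TaylorModelReadout.taylorJet_zero])
    (fun x k c _ => T.wv_taylorJet_qBf_succ x k c) (fun x v c _ => by rw [TaylorModelReadout.varJet_zero])
    (fun x v k c _ => T.wv_varJet_qBf_succ x v k c) (T.isFieldEnclosureA_qBboxMA hco hcB prec)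
    (T.isLinSymEnclosureA_linSym hco hcB prec) K hY hD hy hv k hk c hc

end Sound

end CertTables

end Summit.NavierStokesRegularity.NavierStokesRegularity.Theorems.TaylorModelCert
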